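import Mathlib.Analysis.SpecialFunctions.Pow.Real
import Mathlib.Analysis.SpecialFunctions.Log.Base
import Mathlib.Algebra.BigOperators.Group.List.Basic
import Mathlib.Order.Lattice.Nat
import Mathlib.Data.Fintype.Prod
import Mathlib.Data.Fintype.Pi
import Literature.Computability.Complexity.ConstantDepth
import HarnessLib

/-!
# The average-case depth hierarchy theorem (Rossman–Servedio–Tan 2015, Thm. 1) and the Sipser functions

B. Rossman, R. A. Servedio, L.-Y. Tan, *An average-case depth hierarchy theorem for Boolean
circuits*, FOCS 2015 (arXiv:1504.03398; J. ACM 64 (2017) with J. Håstad) [RossmanServedioTan2015],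
**Theorem 1** (p. 3): "Let `2 ≤ d ≤ c √(log n) / log log n`, where `c > 0` is an absolute constant,
and `Sipser_d` be the explicit `n`-variable read-once monotone depth-`d` formula described in
Section 6. Then any circuit `C` of depth at most `d - 1` and size at most `S = 2^{n^{1/(6(d-1))}}`
over `{0,1}ⁿ` agrees with `Sipser_d` on at most `(1/2 + n^{-Ω(1/d)}) · 2ⁿ` inputs." This is the
theorem quoted verbatim as **Thm. 5.4** of Aaronson–Chen 2017 (arXiv:1612.05903, §5.4, p. 24)
[AaronsonChen2017], where it makes `PH^{TQBF ⊕ O}` infinite for `O ∼ 𝒟_O` (Thm. 5.1); its Thm. 2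
("`PH` is infinite relative to a random oracle") is the tree's named fact
`rossmanServedioTan2015_thm2` (`RandomOraclePH.lean`).

This file transcribes the objects of RST §6–§7.1 as REAL definitions and vendors Theorem 1 and
the printed size estimate of the top fan-in as named facts:

* `Addr ws` — the leaf addresses `A_d = [w₀] × ⋯ × [w_{d-1}]` of the depth-regular tree with
  fan-in sequence `ws = [w₀, …, w_{d-1}]` (§6, "addressing scheme", p. 15), a finite type with
  `Fintype.card (Addr ws) = ws.prod` (`Addr.card`); `addrIndex` its mixed-radix numbering;
* `sipserEval ws isAnd v` — the value of the read-once alternating depth-regular formula with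
  fan-ins `ws` and root gate `∧` (if `isAnd`) / `∨` on the leaf assignment `v : Addr ws → Bool`;
* the parameters of §6–§7.1 (p. 15–16): `rstW m = w = ⌊m 2^m / log e⌋`, `rstP m = p = 2^{-m}`,
  `rstQ m = q = √p`, `rstLam m = λ = (log w)^{3/2} / w^{5/4}`, `rstT m d k = t_k`
  (`t_{d-1} = (p - λ)/q`, `t_{k-1} = ((1 - t_k)^{qw} - λ)/q`), `rstW0 m d = w₀ =` the least
  integer with `(1 - t₁)^{q w₀} ≤ 1/2`, the fan-in sequence `rstFanins m d = [w₀, w, …, w, m]`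
  (`w_{d-1} = m`, `w_k = w` for `1 ≤ k ≤ d - 2`), `rstN m d = n = w₀ w^{d-2} m`, and
  `balancedSipser m d = Sipser_d` (root `∨` iff `d` is even, bottom gates `∧`);
* the named facts `rossmanServedioTan2015_thm1` (Theorem 1, over the tree's unbounded fan-in
  circuits `Circuit`/`acBasis`/`acDepth`/`size` of `Circuit.lean`, `ConstantDepth.lean`) and
  `rossmanServedioTan2015_w0_asymp` ("`w₀ = 2^m ln(2) · (1 ± o_m(1))`", §6 p. 15, in the regime
  `2 ≤ d ≤ c m / log m` of Lemma 7.1);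
* `rossmanServedioTan2015_lem71` — Lemma 7.1 (p. 16: `t_k = q ± q^{1.1}` for all `k ∈ [d-1]`
  whenever `2 ≤ d ≤ c m / log m`) as a named fact;
* `rossmanServedioTan2015_thm1_inRegime` — Theorem 1 with the regime `d ≤ c m / log m` of
  Lemma 7.1 as an explicit hypothesis: the CORRECTED transcription (see its docstring and the
  design note "Circularity of the printed range" below) and the fact downstream files consume
  (`rst_thm1_regime_of_inRegime` in `RandomOraclePHAsymptotics.lean`, whence Thm. 2 in
  `RandomOraclePHProofs.lean`); the literal `rossmanServedioTan2015_thm1` implies it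
  (`rossmanServedioTan2015_thm1_inRegime_of_thm1`) and is kept, with a caveat in its docstring,
  only until its remaining importers are migrated.

## Design notes

* `log` is `log₂` throughout RST (§5.1, p. 13: "We write `log` to denote logarithm base 2"), so
  `1 / log e = ln 2` and the range hypothesis of Theorem 1 is typed with `Real.logb 2`.
* Circuit class. RST (§5.2, p. 13): "The size of a circuit is its number of gates, and the depth of
  a circuit is the length of its longest root-to-leaf path"; circuits are `∧/∨` circuits with
  negations at the leaves, taken alternating and layered "by a standard conversion … with only a
  modest increase in size (which is negligible given the slack on our analysis)". The fact below is
  typed over the tree's straight-line circuits over `acBasis = {¬} ∪ {∧ₖ, ∨ₖ}` with `acDepth`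
  (negations free, as for literals at the leaves) and `size` = number of ALL gates (negation gates
  included, which only shrinks the class); negations inside the circuit are covered by the same
  standard conversion (De Morgan push-down, within the stated slack). This is the convention of the
  tree's other `AC⁰` facts (`RazTal2022_thm74`, `Tal2017_fourierL1_ac0`).
* "`n^{-Ω(1/d)}`" is typed as `n^{-C/d}` for an absolute constant `C > 0`, uniformly for all `d`
  in the printed range and all `m ≥ m₀`, `m₀` the absolute threshold "`m` sufficiently large" of
  §6 (p. 15); likewise the `o_m(1)` of the `w₀` estimate is uniform in `d` within the regime
  `2 ≤ d ≤ c m / log m` of Lemma 7.1 (the threshold `m₀(ε)` depends on `ε` only). Outside that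
  regime the `t`-recurrence (repelling fixed point near `q`, multiplier `≈ m ln 2` per level)
  drifts and `w₀` is junk; the regime hypotheses are where the content is.
* Aaronson–Chen (§5.4, p. 24) apply "the `N`-variable `Sipser_d`" with `N = 2ⁿ` for every `n`,
  but RST's `Sipser_d` exists only on `n = rstN m d = w₀ w^{d-2} m` variables; the leaf deriving
  their Lemma 5.5 / Thm. 5.1 from the fact below bridges this by using `Sipser_d` on its own
  leaves inside a level with `2^ℓ ≥ rstN m d` blocks (injective block assignment `addrIndex`),
  not by a per-`N` formula.
* Degenerate parameters (small `m`: `w = 0`, empty defining set for `w₀`, negative bases of real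
  powers) take Mathlib's junk values (`⌊·⌋₊`, `sInf ∅ = 0`, `Real.rpow`); Theorem 1's range
  hypothesis is then false (`n` small) and the facts say nothing there. The printed estimate
  `w₀ = 2^m ln 2 (1 ± o(1))` is exactly what makes `n → ∞` usable downstream.
* Nothing here is specific to oracles; the application to `PH^{TQBF ⊕ O}` (Aaronson–Chen Lemma 5.5,
  Thm. 5.1 second half = the named fact `aaronsonChen2017_thm51_ph` of
  `Literature/Barriers/QuantumAdvantage/AaronsonChenOracle.lean`) is to be filed as
  `Literature/Barriers/QuantumAdvantage/AaronsonChenPH.lean` and sibling lower-bound files.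

* Circularity of the printed range (found when attempting the discharge of
  `rossmanServedioTan2015_thm1`, 2026-08-15). The range `2 ≤ d ≤ c √(log n)/log log n` of Thm. 1
  is stated through `n = n(m, d) = w₀ w^{d-2} m`, and `w₀` (eq. (9), p. 15) is defined from `t₁`,
  the output of the `(d-2)`-step recurrence (12) (p. 16). The printed proof (§11.2, p. 38:
  "recalling the values of `r, t₁` and `w` in terms of `n` and `d`") runs on eq. (10)
  `n = (1 ± o(1))/log e · (m 2^m/log e)^{d-1}` and the estimates (14), i.e. on Lemma 7.1, whose
  hypothesis `d ≤ c m/log m` is not derived from the range — and cannot be without an a-priori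
  upper bound on `w₀`, which is exactly what Lemma 7.1 (`t₁ = q ± q^{1.1}`) supplies. Outside that
  regime the recurrence drifts (multiplier `≈ -m ln 2` per level, Appendix 12); were it to output a
  tiny positive `t₁` for some `(m, d)`, then `w₀ ≫ 2^m`, `n` is astronomically large, the range
  hypothesis HOLDS, while `Sipser_d` — an `∨` of `w₀` independent subformulas each true with
  probability `≈ 2^{-m}` — is all but constantly `1`, and the one-gate circuit `true` violates the
  conclusion. The source neither excludes nor discusses such pairs, so the literal transcription
  `rossmanServedioTan2015_thm1` is not what the source proves; `rossmanServedioTan2015_thm1_inRegime`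
  adds the regime hypothesis (eventually automatic for fixed `d`, `m → ∞`, the only use downstream:
  `rst_thm1_regime_of_inRegime` in `RandomOraclePHAsymptotics.lean`, [AaronsonChen2017, §5.4]).
  The literal def is kept unchanged (statement and name) for its importers; its docstring now
  carries the caveat.

* Size of a discharge (bad-split review, 2026-08-15). `rossmanServedioTan2015_thm1_inRegime` is
  the paper's main theorem, not a lemma of it: Thm. 1 is the common special case of Thms. 6/7
  (§1.2 p. 4), proved in §11.2–11.3 (pp. 37–38) from Prop. 4 (the `d-1` random projections
  complete to the uniform distribution, §8 pp. 20–23), the projection switching lemmas Props. 5–6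
  and Thms. 9–10 (§9 pp. 24–30), the typicality machinery Props. 10–13 / Lemmas 10–17 (§10
  pp. 31–36) and Prop. 14 (p. 37); Lemma 7.1 (`rossmanServedioTan2015_lem71_holds`) and the `w₀`
  estimate (`rossmanServedioTan2015_w0_asymp_holds`, both in `AverageCaseDepthHierarchyProofs.lean`)
  are the only printed ingredients already proved in the tree. Every other intermediate result is
  internal to this one proof (no independently citable statement), so under D-0026 the fact is
  not split further; it stays a cited named fact until that theory (random projections and their
  switching lemma over `Circuit`) exists.

## Sources

* [RossmanServedioTan2015] arXiv:1504.03398, read via `lit read arxiv:1504.03398` pp. 3 (Thm. 1,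
  Thm. 2), 7 (§2.3), 13 (§5.1–5.3 conventions), 15 (§6: `Sipser_d`, fan-ins, `n`, `w₀` estimate,
  addresses), 16 (§7.1: `λ, q, t_k`, Lemma 7.1).
* [AaronsonChen2017] arXiv:1612.05903 p. 24 (Thm. 5.4 = RST Thm. 1 as used in §5.4).
-/

noncomputable section

namespace Literature.Computability.Complexity

open Finset

/-! ### Leaf addresses and read-once alternating formulas -/

/-- The leaf addresses of the depth-regular read-once formula with fan-in sequence
`ws = [w₀, …, w_{d-1}]`: `Addr [] = Unit` (the root itself) and `Addr (w :: ws) = Fin w × Addr ws`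
(choose a child of the root, then an address below it) — RST's `A_d = {output} × [w₀] × ⋯ × [w_{d-1}]`.
[cite: RossmanServedioTan2015, §6 (addressing scheme, p. 15)] -/
def Addr : List ℕ → Type
  | [] => Unit
  | w :: ws => Fin w × Addr ws

namespace Addr

/-- Leaf addresses form a finite type. [folklore] -/
instance instFintype : (ws : List ℕ) → Fintype (Addr ws)
  | [] => inferInstanceAs (Fintype Unit)
  | w :: ws => haveI := instFintype ws; inferInstanceAs (Fintype (Fin w × Addr ws))

/-- Leaf addresses have decidable equality. [folklore] -/
instance instDecidableEq : (ws : List ℕ) → DecidableEq (Addr ws)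
  | [] => inferInstanceAs (DecidableEq Unit)
  | w :: ws => haveI := instDecidableEq ws; inferInstanceAs (DecidableEq (Fin w × Addr ws))

/-- There are `|A_d| = ∏ₖ wₖ = n` leaves. [cite: RossmanServedioTan2015, §6 (p. 15, "|A_d| = n")] -/
theorem card : ∀ ws : List ℕ, Fintype.card (Addr ws) = ws.prod
  | [] => rfl
  | w :: ws => by
    rw [List.prod_cons, ← card ws]
    exact (Fintype.card_prod (Fin w) (Addr ws)).trans (by rw [Fintype.card_fin])

end Addr

/-- The mixed-radix number of a leaf address: `addrIndex (w :: ws) (i, a) = i + w · addrIndex ws a`,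
an injection of `Addr ws` into `{0, …, ws.prod - 1}`. [folklore] -/
def addrIndex : (ws : List ℕ) → Addr ws → ℕ
  | [], _ => 0
  | w :: ws, (i, a) => (i : ℕ) + w * addrIndex ws a

/-- Leaf numbers are below the number of leaves. [folklore] -/
theorem addrIndex_lt : ∀ (ws : List ℕ) (a : Addr ws), addrIndex ws a < ws.prod
  | [], _ => Nat.zero_lt_one
  | w :: ws, (i, a) => by
    have h := addrIndex_lt ws a
    show (i : ℕ) + w * addrIndex ws a < (w :: ws).prod
    rw [List.prod_cons]
    calc (i : ℕ) + w * addrIndex ws a < w + w * addrIndex ws a := Nat.add_lt_add_right i.isLt _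
      _ = w * (addrIndex ws a + 1) := by ring
      _ ≤ w * ws.prod := Nat.mul_le_mul_left w h

/-- The leaf numbering is injective. [folklore] -/
theorem addrIndex_injective : ∀ ws : List ℕ, Function.Injective (addrIndex ws)
  | [] => fun a b _ => Subsingleton.elim (α := Unit) a b
  | w :: ws => by
    rintro ⟨i, a⟩ ⟨j, b⟩ h
    change (i : ℕ) + w * addrIndex ws a = (j : ℕ) + w * addrIndex ws b at h
    have hi : (i : ℕ) % w = (j : ℕ) % w := by
      have := congr_arg (· % w) h
      simpa [Nat.add_mul_mod_self_left] using this
    rw [Nat.mod_eq_of_lt i.isLt, Nat.mod_eq_of_lt j.isLt] at hi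
    have hij : i = j := Fin.ext hi
    subst hij
    have hw : 0 < w := lt_of_le_of_lt (Nat.zero_le _) i.isLt
    have hab : addrIndex ws a = addrIndex ws b := by
      have := Nat.add_left_cancel h
      exact Nat.eq_of_mul_eq_mul_left hw this
    rw [addrIndex_injective ws hab]

/-- The value of the read-once, alternating, depth-regular formula with fan-in sequence `ws` on the
leaf assignment `v`: a leaf returns its variable; a gate with fan-in `w` is the `∧` (if `isAnd`) or
`∨` (otherwise) of its `w` subformulas, whose gates are of the opposite type ("every root-to-leaf
path alternates between AND gates and OR gates"). [cite: RossmanServedioTan2015, §6 (p. 15)] -/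
def sipserEval : (ws : List ℕ) → Bool → (Addr ws → Bool) → Bool
  | [], _, v => v ()
  | w :: ws, isAnd, v =>
    if isAnd then (List.finRange w).all fun i => sipserEval ws (!isAnd) fun a => v (i, a)
    else (List.finRange w).any fun i => sipserEval ws (!isAnd) fun a => v (i, a)

/-- A leaf formula returns its variable. [cite: RossmanServedioTan2015, §6 (p. 15)] -/
@[simp] theorem sipserEval_nil (b : Bool) (v : Addr [] → Bool) : sipserEval [] b v = v () := rfl

/-- An `∧` gate is true iff all its subformulas are. [cite: RossmanServedioTan2015, §6 (p. 15)] -/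
theorem sipserEval_cons_true (w : ℕ) (ws : List ℕ) (v : Addr (w :: ws) → Bool) :
    sipserEval (w :: ws) true v = true ↔ ∀ i : Fin w, sipserEval ws false (fun a => v (i, a)) = true := by
  simp [sipserEval, List.all_eq_true]

/-- An `∨` gate is true iff some subformula is. [cite: RossmanServedioTan2015, §6 (p. 15)] -/
theorem sipserEval_cons_false (w : ℕ) (ws : List ℕ) (v : Addr (w :: ws) → Bool) :
    sipserEval (w :: ws) false v = true ↔ ∃ i : Fin w, sipserEval ws true (fun a => v (i, a)) = true := by
  simp [sipserEval, List.any_eq_true]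

/-! ### The parameters of RST §6–§7.1 -/

/-- The middle fan-in `w := ⌊m 2^m / log e⌋ = ⌊m 2^m ln 2⌋` (`log = log₂`).
[cite: RossmanServedioTan2015, §6 (p. 15, eq. for w)] -/
def rstW (m : ℕ) : ℕ := ⌊(m : ℝ) * 2 ^ m * Real.log 2⌋₊

/-- `p := 2^{-w_{d-1}} = 2^{-m}`, the probability that a bottom `∧` gate is satisfied by a uniform
input. [cite: RossmanServedioTan2015, §6 (p. 15)] -/
def rstP (m : ℕ) : ℝ := (2 : ℝ) ^ (-(m : ℝ))

/-- `q := √p = 2^{-m/2}`. [cite: RossmanServedioTan2015, §7.1 (p. 16)] -/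
def rstQ (m : ℕ) : ℝ := (2 : ℝ) ^ (-(m : ℝ) / 2)

/-- `λ := (log w)^{3/2} / w^{5/4}` (`log = log₂`). [cite: RossmanServedioTan2015, §7.1 (p. 16)] -/
def rstLam (m : ℕ) : ℝ := Real.logb 2 (rstW m) ^ ((3 : ℝ) / 2) / (rstW m : ℝ) ^ ((5 : ℝ) / 4)

/-- The sequence `t_{d-1}, …, t₁` counted from the top index: `rstTAux m j = t_{d-1-j}`, i.e.
`rstTAux m 0 = t_{d-1} = (p - λ)/q` and `rstTAux m (j+1) = ((1 - rstTAux m j)^{q w} - λ)/q`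
(`t_{k-1} = ((1 - t_k)^{qw} - λ)/q`; real powers). [cite: RossmanServedioTan2015, §7.1 (p. 16, definition of t_k)] -/
def rstTAux (m : ℕ) : ℕ → ℝ
  | 0 => (rstP m - rstLam m) / rstQ m
  | j + 1 => ((1 - rstTAux m j) ^ (rstQ m * rstW m) - rstLam m) / rstQ m

/-- `t_k` for the depth `d` (`1 ≤ k ≤ d - 1`): `t_{d-1} = (p - λ)/q`, `t_{k-1} = ((1 - t_k)^{qw} - λ)/q`.
[cite: RossmanServedioTan2015, §7.1 (p. 16)] -/
def rstT (m d k : ℕ) : ℝ := rstTAux m (d - 1 - k)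

/-- The top fan-in `w₀ :=` the smallest integer such that `(1 - t₁)^{q w₀} ≤ 1/2` (`Nat.sInf`, so
`0` if no such integer exists, which does not happen in RST's regime). [cite: RossmanServedioTan2015, §6 (p. 15, eq. for w₀)] -/
def rstW0 (m d : ℕ) : ℕ := sInf {w₀ : ℕ | (1 - rstT m d 1) ^ (rstQ m * w₀) ≤ (1 : ℝ) / 2}

/-- The fan-in sequence `[w₀, w₁, …, w_{d-1}] = [w₀, w, …, w, m]` of `Sipser_d` (top fan-in `w₀`,
`w_k = w` for `1 ≤ k ≤ d - 2`, bottom fan-in `w_{d-1} = m`); meaningful for `d ≥ 2`.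
[cite: RossmanServedioTan2015, §6 (p. 15)] -/
def rstFanins (m d : ℕ) : List ℕ := rstW0 m d :: (List.replicate (d - 2) (rstW m) ++ [m])

/-- The number of variables `n = ∏ₖ wₖ = w₀ w^{d-2} m` of `Sipser_d`. [cite: RossmanServedioTan2015, §6 (p. 15)] -/
def rstN (m d : ℕ) : ℕ := (rstFanins m d).prod

/-- For `d ≥ 2` the fan-in sequence has length `d` (the formula has depth `d`). [cite: RossmanServedioTan2015, §6 (p. 15)] -/
theorem length_rstFanins {d : ℕ} (hd : 2 ≤ d) (m : ℕ) : (rstFanins m d).length = d := by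
  simp [rstFanins]; omega

/-- `n = w₀ · w^{d-2} · m`. [cite: RossmanServedioTan2015, §6 (p. 15)] -/
theorem rstN_eq (m d : ℕ) : rstN m d = rstW0 m d * rstW m ^ (d - 2) * m := by
  simp [rstN, rstFanins, List.prod_replicate, mul_assoc]

/-- The number of leaves of `Sipser_d` is `n`. [cite: RossmanServedioTan2015, §6 (p. 15)] -/
theorem card_addr_rstFanins (m d : ℕ) : Fintype.card (Addr (rstFanins m d)) = rstN m d :=
  Addr.card _

/-- **RST's `Sipser_d`** with asymptotic parameter `m`: the read-once alternating depth-regular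
formula with fan-ins `rstFanins m d`, whose root is an `∨` gate if `d` is even and an `∧` gate if
`d` is odd (so that the gates adjacent to the inputs are `∧` gates), as a Boolean function of its
`n` leaves. [cite: RossmanServedioTan2015, §6 (p. 15)] -/
def balancedSipser (m d : ℕ) (x : Addr (rstFanins m d) → Bool) : Bool :=
  sipserEval (rstFanins m d) (Nat.bodd d) x

/-! ### The named facts -/

/-- **Rossman–Servedio–Tan 2015, Theorem 1 (= Aaronson–Chen 2017, Thm. 5.4): the average-case
depth hierarchy theorem.** There are absolute constants `c, C > 0` and `m₀` such that for all
`d ≥ 2` and all `m ≥ m₀` ("`m` sufficiently large", §6) with `d ≤ c √(log n) / log log n`,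
`n = rstN m d` (`log = log₂`), every
circuit over `{∧, ∨, ¬}` (unbounded fan-in, negations free for depth) of depth at most `d - 1` and
at most `2^{n^{1/(6(d-1))}}` gates, on the `n` leaves of `Sipser_d`, agrees with `Sipser_d` on at
most `(1/2 + n^{-C/d}) · 2ⁿ` of the `2ⁿ` inputs. See the module docstring for the circuit
conventions ("size = number of gates, depth = longest path", alternating/layered form "by a
standard conversion … negligible given the slack") and the reading of `n^{-Ω(1/d)}`.

**Caveat — literal transcription; take `rossmanServedioTan2015_thm1_inRegime` instead.** The range
hypothesis is typed through `n = rstN m d`, whose top fan-in `w₀` is defined from the recurrence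
output `t₁` for EVERY pair `(m, d)`, including pairs outside the regime `d ≤ c m / log m` of
Lemma 7.1 where the printed proof does not run and the recurrence takes junk values (design note
"Circularity of the printed range" in the module docstring). This def therefore also speaks about
pairs on which the source is silent; the corrected transcription
`rossmanServedioTan2015_thm1_inRegime` (implied by this one,
`rossmanServedioTan2015_thm1_inRegime_of_thm1`) is what [RossmanServedioTan2015] proves and what
the tree consumes. Kept unchanged for its remaining importers.
[cite: RossmanServedioTan2015, Thm. 1 (p. 3; §5.2 p. 13 for conventions)] [cite: AaronsonChen2017, Thm. 5.4 (p. 24)] -/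
def rossmanServedioTan2015_thm1 : Prop :=
  ∃ c : ℝ, 0 < c ∧ ∃ C : ℝ, 0 < C ∧ ∃ m₀ : ℕ, ∀ (d m : ℕ), 2 ≤ d → m₀ ≤ m →
    (d : ℝ) ≤ c * Real.sqrt (Real.logb 2 (rstN m d)) / Real.logb 2 (Real.logb 2 (rstN m d)) →
    ∀ F : Circuit (Addr (rstFanins m d)), F.IsOver acBasis → F.acDepth ≤ d - 1 →
      (F.size : ℝ) ≤ (2 : ℝ) ^ ((rstN m d : ℝ) ^ (1 / (6 * ((d : ℝ) - 1)))) →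
      (((univ : Finset (Addr (rstFanins m d) → Bool)).filter
          fun x => F.eval x = balancedSipser m d x).card : ℝ) ≤
        (1 / 2 + (rstN m d : ℝ) ^ (-C / (d : ℝ))) * (2 : ℝ) ^ rstN m d

/-- **Rossman–Servedio–Tan 2015, §6 (p. 15): the top fan-in is `w₀ = 2^m ln(2) · (1 ± o_m(1))`**
("The estimates for `t₁` and `q` given in Lemma 7.1 imply that `w₀ = 2^m ln(2) · (1 ± o_m(1))`"),
in the regime `2 ≤ d ≤ c m / log m` of Lemma 7.1 ("there is a universal constant `c > 0` such that
for `2 ≤ d ≤ c m / log m`, we have that `t_k = q ± q^{1.1}` for all `k ∈ [d-1]`"): for every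
`ε > 0`, for all large `m` (threshold depending on `ε` only) and all `d` in that regime,
`|w₀ / (2^m ln 2) - 1| ≤ ε`. Consequently
`n = (1 ± o(1))/log e · (m 2^m / log e)^{d-1}` (ibid.). [cite: RossmanServedioTan2015, §6 (p. 15) and Lemma 7.1 (p. 16)] -/
def rossmanServedioTan2015_w0_asymp : Prop :=
  ∃ c : ℝ, 0 < c ∧ ∀ ε : ℝ, 0 < ε → ∃ m₀ : ℕ, ∀ m : ℕ, m₀ ≤ m → ∀ d : ℕ, 2 ≤ d →
    (d : ℝ) ≤ c * m / Real.logb 2 m →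
      |(rstW0 m d : ℝ) / (2 ^ m * Real.log 2) - 1| ≤ ε

/-! ### Lemma 7.1 and Theorem 1 in its regime (corrected transcription) -/

/-- **Rossman–Servedio–Tan 2015, Lemma 7.1** ("the values `t_k` stay under control"): "There is a
universal constant `c > 0` such that for `2 ≤ d ≤ c m / log m`, we have that `t_k = q ± q^{1.1}`
for all `k ∈ [d-1]`" (`log = log₂`; proved in Appendix 12 by the downward induction
`|t_k q - p| ≤ (2m)^{d-1-k} λ`, eq. (25)). As printed there is no separate "`m` large": `d ≥ 2`
and `d ≤ c m / log₂ m` force `m ≥ 2/c`. This is the hypothesis-supplier of eq. (10) and of the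
`w₀` estimate `rossmanServedioTan2015_w0_asymp`. [cite: RossmanServedioTan2015, Lemma 7.1 (p. 16; proof: Appendix 12, p. 41)] -/
def rossmanServedioTan2015_lem71 : Prop :=
  ∃ c : ℝ, 0 < c ∧ ∀ m d : ℕ, 2 ≤ d → (d : ℝ) ≤ c * m / Real.logb 2 m →
    ∀ k : ℕ, 1 ≤ k → k ≤ d - 1 → |rstT m d k - rstQ m| ≤ rstQ m ^ (1.1 : ℝ)

/-- **Rossman–Servedio–Tan 2015, Theorem 1, in the regime `2 ≤ d ≤ c m / log m` of Lemma 7.1**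
(corrected transcription of `rossmanServedioTan2015_thm1`; same source, same constants otherwise).
There are absolute constants `c, C > 0` and `m₀` such that for all `d ≥ 2` and `m ≥ m₀` with
`d ≤ c m / log₂ m` (the hypothesis of Lemma 7.1, p. 16, under which `t_k = q ± q^{1.1}`, hence
`w₀ = 2^m ln 2 (1 ± o(1))` and eq. (10) for `n` hold) and `d ≤ c √(log₂ n)/log₂ log₂ n`,
`n = rstN m d` (the printed range), every circuit over `{∧, ∨, ¬}` of depth at most `d - 1` and at
most `2^{n^{1/(6(d-1))}}` gates on the `n` leaves of `Sipser_d` agrees with `Sipser_d` on at most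
`(1/2 + n^{-C/d}) · 2ⁿ` inputs. Why the extra hypothesis: the printed range is expressed through
`n = w₀ w^{d-2} m`, whose `w₀` is defined from the recurrence output `t₁`; the printed proof
(§11.2) uses eq. (10) and (14), consequences of Lemma 7.1, whose regime hypothesis does not follow
from the range without an a-priori bound on `w₀` (see the module design note "Circularity of the
printed range"); outside the regime the literal statement speaks about pairs `(m, d)` on which the
source is silent (and is false at any pair where the drifting recurrence returns a tiny positive
`t₁`). For fixed `d` and `m → ∞` the added hypothesis is eventually automatic, so every printed
use ([AaronsonChen2017, Thm. 5.4]; `rst_thm1_regime_of_inRegime` in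
`RandomOraclePHAsymptotics.lean`) is unaffected. Formalization size: the whole of RST §8–§11
(see the module design note "Size of a discharge").
[cite: RossmanServedioTan2015, Thm. 1 (p. 3) with Lemma 7.1 (p. 16) and §6 eq. (10) (p. 15)] -/
def rossmanServedioTan2015_thm1_inRegime : Prop :=
  ∃ c : ℝ, 0 < c ∧ ∃ C : ℝ, 0 < C ∧ ∃ m₀ : ℕ, ∀ (d m : ℕ), 2 ≤ d → m₀ ≤ m →
    (d : ℝ) ≤ c * m / Real.logb 2 m →
    (d : ℝ) ≤ c * Real.sqrt (Real.logb 2 (rstN m d)) / Real.logb 2 (Real.logb 2 (rstN m d)) →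
    ∀ F : Circuit (Addr (rstFanins m d)), F.IsOver acBasis → F.acDepth ≤ d - 1 →
      (F.size : ℝ) ≤ (2 : ℝ) ^ ((rstN m d : ℝ) ^ (1 / (6 * ((d : ℝ) - 1)))) →
      (((univ : Finset (Addr (rstFanins m d) → Bool)).filter
          fun x => F.eval x = balancedSipser m d x).card : ℝ) ≤
        (1 / 2 + (rstN m d : ℝ) ^ (-C / (d : ℝ))) * (2 : ℝ) ^ rstN m d

/-- The literal transcription `rossmanServedioTan2015_thm1` implies the regime-restricted
`rossmanServedioTan2015_thm1_inRegime` (the extra hypothesis is simply dropped). [folklore] -/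
theorem rossmanServedioTan2015_thm1_inRegime_of_thm1 (h : rossmanServedioTan2015_thm1) :
    rossmanServedioTan2015_thm1_inRegime := by
  obtain ⟨c, hc, C, hC, m₀, h⟩ := h
  exact ⟨c, hc, C, hC, m₀, fun d m hd hm _ hrange => h d m hd hm hrange⟩

end Literature.Computability.Complexity

end
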